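import Mathlib
import Literature.Probability.LatticeModels.TriangularLatticeProofs
import HarnessLib

/-!
# Riemann sums over the triangular lattice (crux `BoundaryClosureR`, stmt-CriticalPhenomena-14004,
line `pick-half-plane`, stub `stub_developingMapLimitHolomorphic`; pure analysis helper)

For a continuous compactly supported `f : ℂ → ℂ` the lattice sums `δ² Σ_{s ∈ ℤ²} f(δ · s)` over
the square lattice converge to `∫ f` as `δ → 0⁺` (`tendsto_sqLattice_sum`, dominated convergence
for the step function constant on the mesh cells), and over the equilateral triangular lattice
`triEmbed ℤ² = ℤ + ζℤ` (unit spacing, cell area `√3/2`) they converge to `(2/√3) ∫ f`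
(`tendsto_triLattice_sum`, linear change of variables `x + iy ↦ x + yζ` of determinant `√3/2`).
Corollary: `δ²·#{s : δ·triEmbed s ∈ K}` is eventually bounded for every compact `K`
(`developingMapLimitHolomorphic_riemann`, registered helper).  References: folklore.
-/

noncomputable section

open scoped Topology
open Filter Set MeasureTheory Metric Complex
open Literature.Probability.LatticeModels

namespace Summit.CriticalPhenomena.SAWScalingLimit.Theorems.PickHalfPlane.DevelopingMap

/-! ### The square lattice -/

/-- `|δ ⌊x/δ⌋ - x| ≤ δ` for `δ > 0`. [folklore] -/
theorem abs_mul_floor_div_sub_le {δ : ℝ} (hδ : 0 < δ) (x : ℝ) :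
    |δ * (⌊x / δ⌋ : ℝ) - x| ≤ δ := by
  have h1 : ((⌊x / δ⌋ : ℤ) : ℝ) ≤ x / δ := Int.floor_le _
  have h2 : x / δ < ((⌊x / δ⌋ : ℤ) : ℝ) + 1 := Int.lt_floor_add_one _
  have h1' : δ * ((⌊x / δ⌋ : ℤ) : ℝ) ≤ x := by
    have := mul_le_mul_of_nonneg_left h1 hδ.le
    rwa [mul_div_cancel₀ _ hδ.ne'] at this
  have h2' : x < δ * ((⌊x / δ⌋ : ℤ) : ℝ) + δ := by
    have := mul_lt_mul_of_pos_left h2 hδ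
    rwa [mul_add, mul_one, mul_div_cancel₀ _ hδ.ne'] at this
  rw [abs_le]
  constructor <;> linarith

/-- The mesh point of the square lattice below-left of `z` is within `2δ` of `z`. [folklore] -/
theorem dist_meshPoint_le {δ : ℝ} (hδ : 0 < δ) (z : ℂ) :
    dist ((δ : ℂ) * (((⌊z.re / δ⌋ : ℤ) : ℂ) + ((⌊z.im / δ⌋ : ℤ) : ℂ) * I)) z ≤ 2 * δ := by
  have hre := abs_mul_floor_div_sub_le hδ z.re
  have him := abs_mul_floor_div_sub_le hδ z.im
  rw [dist_eq_norm]
  have hdecomp : (δ : ℂ) * (((⌊z.re / δ⌋ : ℤ) : ℂ) + ((⌊z.im / δ⌋ : ℤ) : ℂ) * I) - z =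
      ((δ * (⌊z.re / δ⌋ : ℝ) - z.re : ℝ) : ℂ) + ((δ * (⌊z.im / δ⌋ : ℝ) - z.im : ℝ) : ℂ) * I := by
    apply Complex.ext <;> simp
  rw [hdecomp]
  calc ‖((δ * (⌊z.re / δ⌋ : ℝ) - z.re : ℝ) : ℂ) + ((δ * (⌊z.im / δ⌋ : ℝ) - z.im : ℝ) : ℂ) * I‖
      ≤ ‖((δ * (⌊z.re / δ⌋ : ℝ) - z.re : ℝ) : ℂ)‖ + ‖((δ * (⌊z.im / δ⌋ : ℝ) - z.im : ℝ) : ℂ) * I‖ :=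
        norm_add_le _ _
    _ = |δ * (⌊z.re / δ⌋ : ℝ) - z.re| + |δ * (⌊z.im / δ⌋ : ℝ) - z.im| := by
        rw [norm_mul, Complex.norm_I, mul_one, Complex.norm_real, Complex.norm_real,
          Real.norm_eq_abs, Real.norm_eq_abs]
    _ ≤ δ + δ := add_le_add hre him
    _ = 2 * δ := by ring

/-- Lattice points of `δℤ²` in a ball: if `‖δ·(s₀ + i s₁)‖ ≤ R` then `|s_i| ≤ R/δ`; in particular
the set of such `s` is finite. [folklore] -/
theorem finite_sqLattice_norm_le {δ : ℝ} (hδ : 0 < δ) (R : ℝ) :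
    {s : Site 2 | ‖(δ : ℂ) * ((s 0 : ℂ) + (s 1 : ℂ) * I)‖ ≤ R}.Finite := by
  set N : ℤ := ⌈R / δ⌉ with hN
  refine (Set.Finite.pi (ι := Fin 2) (t := fun _ => Set.Icc (-N) N) fun _ => Set.finite_Icc _ _).subset ?_
  intro s hs
  simp only [Set.mem_setOf_eq] at hs
  rw [norm_mul, Complex.norm_real, Real.norm_eq_abs, abs_of_pos hδ] at hs
  have hre : |(s 0 : ℝ)| ≤ ‖((s 0 : ℂ) + (s 1 : ℂ) * I)‖ := by
    have := Complex.abs_re_le_norm ((s 0 : ℂ) + (s 1 : ℂ) * I)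
    simpa using this
  have him : |(s 1 : ℝ)| ≤ ‖((s 0 : ℂ) + (s 1 : ℂ) * I)‖ := by
    have := Complex.abs_im_le_norm ((s 0 : ℂ) + (s 1 : ℂ) * I)
    simpa using this
  have hbound : ∀ i : Fin 2, |(s i : ℝ)| ≤ R / δ := by
    intro i
    rw [le_div_iff₀ hδ, mul_comm]
    fin_cases i
    · exact (mul_le_mul_of_nonneg_left hre hδ.le).trans hs
    · exact (mul_le_mul_of_nonneg_left him hδ.le).trans hs
  simp only [Set.mem_pi, Set.mem_univ, Set.mem_Icc, forall_true_left]
  intro i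
  have h := (hbound i).trans (Int.le_ceil _)
  rw [← hN, abs_le] at h
  exact ⟨by exact_mod_cast h.1, by exact_mod_cast h.2⟩

/-- The support of `s ↦ g(δ·(s₀ + i s₁))` is finite for compactly supported `g` and `δ > 0`.
[folklore] -/
theorem finite_support_sqLattice {g : ℂ → ℂ} (hgc : HasCompactSupport g) {δ : ℝ} (hδ : 0 < δ) :
    (Function.support fun s : Site 2 => g ((δ : ℂ) * ((s 0 : ℂ) + (s 1 : ℂ) * I))).Finite := by
  obtain ⟨R, hR⟩ := hgc.isCompact.isBounded.subset_closedBall 0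
  refine (finite_sqLattice_norm_le hδ R).subset fun s hs => ?_
  have hK : (δ : ℂ) * ((s 0 : ℂ) + (s 1 : ℂ) * I) ∈ tsupport g :=
    subset_tsupport _ (Function.mem_support.2 hs)
  have := hR hK
  rwa [mem_closedBall, dist_zero_right] at this

/-- **Riemann sums over the square lattice**: for continuous compactly supported `g : ℂ → ℂ`,
`δ² Σ_{s ∈ ℤ²} g(δ(s₀ + i s₁)) → ∫ g` as `δ → 0⁺`.  Proof: the step function equal to
`g(δ s)` on the mesh cell `δ(s + [0,1)²)` has integral `δ² Σ_s g(δ s)`, converges pointwise to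
`g` and is dominated by `sup |g|` on a fixed compact; dominated convergence. [folklore] -/
theorem tendsto_sqLattice_sum {g : ℂ → ℂ} (hg : Continuous g) (hgc : HasCompactSupport g) :
    Tendsto (fun δ : ℝ => (δ : ℂ) ^ 2 *
      ∑ᶠ s : Site 2, g ((δ : ℂ) * ((s 0 : ℂ) + (s 1 : ℂ) * I))) (𝓝[>] 0) (𝓝 (∫ z, g z)) := by
  classical
  obtain ⟨C, hC⟩ := hg.bounded_above_of_compact_support hgc
  set K : Set ℂ := tsupport g with hKdef
  have hK : IsCompact K := hgc
  -- the mesh point and the step function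
  set P : ℝ → ℂ → ℂ := fun δ z =>
    (δ : ℂ) * (((⌊z.re / δ⌋ : ℤ) : ℂ) + ((⌊z.im / δ⌋ : ℤ) : ℂ) * I) with hP
  set G : ℝ → ℂ → ℂ := fun δ z => g (P δ z) with hG
  have hPm : ∀ δ : ℝ, Measurable (P δ) := by
    intro δ
    have h1 : Measurable fun z : ℂ => ((⌊z.re / δ⌋ : ℤ) : ℂ) :=
      (measurable_of_countable (fun n : ℤ => (n : ℂ))).comp
        (Int.measurable_floor.comp (Complex.measurable_re.div_const δ))
    have h2 : Measurable fun z : ℂ => ((⌊z.im / δ⌋ : ℤ) : ℂ) :=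
      (measurable_of_countable (fun n : ℤ => (n : ℂ))).comp
        (Int.measurable_floor.comp (Complex.measurable_im.div_const δ))
    exact (h1.add (h2.mul_const I)).const_mul _
  ---------------------------------------------------------------- (A) the integral of the step function
  have hA : ∀ δ : ℝ, 0 < δ → ∫ z, G δ z =
      (δ : ℂ) ^ 2 * ∑ᶠ s : Site 2, g ((δ : ℂ) * ((s 0 : ℂ) + (s 1 : ℂ) * I)) := by
    intro δ hδ
    have hfin := finite_support_sqLattice hgc hδ
    set T : Finset (Site 2) := hfin.toFinset with hT
    have hsuppT : (Function.support fun s : Site 2 => g ((δ : ℂ) * ((s 0 : ℂ) + (s 1 : ℂ) * I))) ⊆ ↑T := by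
      rw [hT, Set.Finite.coe_toFinset]
    rw [finsum_eq_sum_of_support_subset _ hsuppT]
    -- the cells
    set cell : Site 2 → Set ℂ := fun s => {z : ℂ | ⌊z.re / δ⌋ = s 0 ∧ ⌊z.im / δ⌋ = s 1} with hcell
    have hcell_eq : ∀ s : Site 2, cell s = Complex.measurableEquivRealProd ⁻¹'
        (Set.Ico (δ * (s 0 : ℝ)) (δ * (s 0 : ℝ) + δ) ×ˢ Set.Ico (δ * (s 1 : ℝ)) (δ * (s 1 : ℝ) + δ)) := by
      intro s
      ext z
      simp only [hcell, Set.mem_setOf_eq, Set.mem_preimage, Complex.measurableEquivRealProd_apply,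
        Set.mem_prod, Set.mem_Ico, Int.floor_eq_iff]
      rw [le_div_iff₀ hδ, div_lt_iff₀ hδ, le_div_iff₀ hδ, div_lt_iff₀ hδ]
      constructor
      · rintro ⟨⟨h1, h2⟩, h3, h4⟩; refine ⟨⟨by linarith, by linarith⟩, by linarith, by linarith⟩
      · rintro ⟨⟨h1, h2⟩, h3, h4⟩; refine ⟨⟨by linarith, by linarith⟩, by linarith, by linarith⟩
    have hcell_meas : ∀ s : Site 2, MeasurableSet (cell s) := fun s => by
      rw [hcell_eq]
      exact Complex.measurableEquivRealProd.measurable (measurableSet_Ico.prod measurableSet_Ico)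
    have hcell_vol : ∀ s : Site 2, volume (cell s) = ENNReal.ofReal (δ ^ 2) := fun s => by
      rw [hcell_eq, Complex.volume_preserving_equiv_real_prod.measure_preimage
        (measurableSet_Ico.prod measurableSet_Ico).nullMeasurableSet, Measure.volume_eq_prod,
        Measure.prod_prod, Real.volume_Ico, Real.volume_Ico, ← ENNReal.ofReal_mul (by linarith)]
      congr 1; ring
    -- the step function as a finite sum of indicators
    have hGsum : ∀ z : ℂ, G δ z = ∑ s ∈ T,
        (cell s).indicator (fun _ => g ((δ : ℂ) * ((s 0 : ℂ) + (s 1 : ℂ) * I))) z := by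
      intro z
      set sz : Site 2 := ![⌊z.re / δ⌋, ⌊z.im / δ⌋] with hsz
      have hmem : ∀ s : Site 2, z ∈ cell s ↔ s = sz := by
        intro s
        simp only [hcell, Set.mem_setOf_eq, hsz]
        constructor
        · rintro ⟨h0, h1⟩
          ext i; fin_cases i <;> simp [h0, h1]
        · rintro rfl; simp
      have hind : ∀ s : Site 2, (cell s).indicator
          (fun _ => g ((δ : ℂ) * ((s 0 : ℂ) + (s 1 : ℂ) * I))) z =
          if s = sz then g ((δ : ℂ) * ((s 0 : ℂ) + (s 1 : ℂ) * I)) else 0 := by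
        intro s
        by_cases h : s = sz
        · rw [if_pos h, Set.indicator_of_mem ((hmem s).2 h)]
        · rw [if_neg h, Set.indicator_of_notMem (fun h' => h ((hmem s).1 h'))]
      simp only [hind]
      rw [Finset.sum_ite_eq']
      have hGz : G δ z = g ((δ : ℂ) * ((sz 0 : ℂ) + (sz 1 : ℂ) * I)) := by
        simp [hG, hP, hsz]
      by_cases hT' : sz ∈ T
      · rw [if_pos hT', hGz]
      · rw [if_neg hT', hGz]
        by_contra hne
        exact hT' (hsuppT (Function.mem_support.2 hne))
    have hint : ∀ s ∈ T, Integrable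
        ((cell s).indicator fun _ : ℂ => g ((δ : ℂ) * ((s 0 : ℂ) + (s 1 : ℂ) * I))) volume := by
      intro s _
      refine (integrable_indicator_iff (hcell_meas s)).2 (integrableOn_const ?_)
      rw [hcell_vol]; exact ENNReal.ofReal_ne_top
    calc ∫ z, G δ z = ∫ z, ∑ s ∈ T,
          (cell s).indicator (fun _ => g ((δ : ℂ) * ((s 0 : ℂ) + (s 1 : ℂ) * I))) z :=
          integral_congr_ae (Eventually.of_forall hGsum)
      _ = ∑ s ∈ T, ∫ z, (cell s).indicator (fun _ => g ((δ : ℂ) * ((s 0 : ℂ) + (s 1 : ℂ) * I))) z :=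
          integral_finsetSum _ hint
      _ = ∑ s ∈ T, (δ ^ 2 : ℝ) • g ((δ : ℂ) * ((s 0 : ℂ) + (s 1 : ℂ) * I)) := by
          refine Finset.sum_congr rfl fun s _ => ?_
          rw [integral_indicator_const _ (hcell_meas s), measureReal_def, hcell_vol,
            ENNReal.toReal_ofReal (sq_nonneg δ)]
      _ = (δ : ℂ) ^ 2 * ∑ s ∈ T, g ((δ : ℂ) * ((s 0 : ℂ) + (s 1 : ℂ) * I)) := by
          rw [Finset.mul_sum]
          refine Finset.sum_congr rfl fun s _ => ?_
          rw [Complex.real_smul]; push_cast; ring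
  ---------------------------------------------------------------- (B) dominated convergence
  have hB : Tendsto (fun δ : ℝ => ∫ z, G δ z) (𝓝[>] 0) (𝓝 (∫ z, g z)) := by
    have hK2 : IsCompact (cthickening 2 K) := hK.cthickening
    refine tendsto_integral_filter_of_dominated_convergence
      (bound := (cthickening 2 K).indicator fun _ => C) ?_ ?_ ?_ ?_
    · exact Eventually.of_forall fun δ => (hg.measurable.comp (hPm δ)).aestronglyMeasurable
    · have hsmall : ∀ᶠ δ : ℝ in 𝓝[>] 0, δ ∈ Set.Ioo (0 : ℝ) 1 := Ioo_mem_nhdsGT one_pos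
      filter_upwards [hsmall] with δ hδ
      refine Eventually.of_forall fun z => ?_
      by_cases hz : z ∈ cthickening 2 K
      · rw [Set.indicator_of_mem hz]; exact hC _
      · rw [Set.indicator_of_notMem hz]
        have h0 : G δ z = 0 := by
          by_contra hne
          have hPK : P δ z ∈ K := subset_tsupport _ (Function.mem_support.2 hne)
          exact hz (mem_cthickening_of_dist_le z (P δ z) 2 K hPK
            (by rw [dist_comm]; linarith [dist_meshPoint_le hδ.1 z, hδ.2]))
        rw [h0, norm_zero]
    · exact (integrable_indicator_iff hK2.isClosed.measurableSet).2
        (integrableOn_const hK2.measure_lt_top.ne)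
    · refine Eventually.of_forall fun z => ?_
      have hPz : Tendsto (fun δ : ℝ => P δ z) (𝓝[>] 0) (𝓝 z) := by
        rw [tendsto_iff_dist_tendsto_zero]
        have h2 : Tendsto (fun δ : ℝ => 2 * δ) (𝓝[>] (0 : ℝ)) (𝓝 0) := by
          have : Tendsto (fun δ : ℝ => 2 * δ) (𝓝 (0 : ℝ)) (𝓝 (2 * 0)) :=
            tendsto_id.const_mul 2
          rw [mul_zero] at this
          exact this.mono_left nhdsWithin_le_nhds
        refine squeeze_zero' (Eventually.of_forall fun δ => dist_nonneg) ?_ h2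
        filter_upwards [self_mem_nhdsWithin] with δ hδ using dist_meshPoint_le hδ z
      exact (hg.tendsto z).comp hPz
  ---------------------------------------------------------------- conclusion
  refine hB.congr' ?_
  filter_upwards [self_mem_nhdsWithin] with δ hδ using hA δ hδ

/-! ### The triangular lattice -/

/-- Lattice points of `δ·triEmbed ℤ²` in a ball: finitely many. [folklore] -/
theorem finite_triLattice_norm_le {δ : ℝ} (hδ : 0 < δ) (R : ℝ) :
    {s : Site 2 | ‖(δ : ℂ) * triEmbed s‖ ≤ R}.Finite := by
  set N : ℤ := ⌈2 * R / δ⌉ with hN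
  refine (Set.Finite.pi (ι := Fin 2) (t := fun _ => Set.Icc (-N) N) fun _ => Set.finite_Icc _ _).subset ?_
  intro s hs
  simp only [Set.mem_setOf_eq] at hs
  rw [norm_mul, Complex.norm_real, Real.norm_eq_abs, abs_of_pos hδ] at hs
  have h3 : (1 : ℝ) < Real.sqrt 3 := by
    rw [show (1 : ℝ) = Real.sqrt 1 from Real.sqrt_one.symm]
    exact Real.sqrt_lt_sqrt (by norm_num) (by norm_num)
  have hre_eq : (triEmbed s).re = (s 0 : ℝ) + (s 1 : ℝ) / 2 := by
    simp [triEmbed]; ring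
  have him_eq : (triEmbed s).im = (s 1 : ℝ) * (Real.sqrt 3 / 2) := by
    simp [triEmbed]
  have hn0 : 0 ≤ ‖triEmbed s‖ := norm_nonneg _
  have hre : |(triEmbed s).re| ≤ ‖triEmbed s‖ := Complex.abs_re_le_norm _
  have him : |(triEmbed s).im| ≤ ‖triEmbed s‖ := Complex.abs_im_le_norm _
  rw [hre_eq] at hre
  rw [him_eq, abs_mul, abs_of_pos (by positivity : (0 : ℝ) < Real.sqrt 3 / 2)] at him
  have h1 : |(s 1 : ℝ)| ≤ 2 * ‖triEmbed s‖ := by nlinarith [abs_nonneg (s 1 : ℝ)]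
  have h0 : |(s 0 : ℝ)| ≤ 2 * ‖triEmbed s‖ := by
    have := abs_add_le ((s 0 : ℝ) + (s 1 : ℝ) / 2) (-((s 1 : ℝ) / 2))
    rw [add_neg_cancel_right, abs_neg, abs_div, abs_two] at this
    linarith
  have hbound : ∀ i : Fin 2, |(s i : ℝ)| ≤ 2 * R / δ := by
    intro i
    rw [le_div_iff₀ hδ]
    fin_cases i
    · calc |((s 0 : ℤ) : ℝ)| * δ ≤ 2 * ‖triEmbed s‖ * δ := by gcongr
        _ = 2 * (δ * ‖triEmbed s‖) := by ring
        _ ≤ 2 * R := by linarith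
    · calc |((s 1 : ℤ) : ℝ)| * δ ≤ 2 * ‖triEmbed s‖ * δ := by gcongr
        _ = 2 * (δ * ‖triEmbed s‖) := by ring
        _ ≤ 2 * R := by linarith
  simp only [Set.mem_pi, Set.mem_univ, Set.mem_Icc, forall_true_left]
  intro i
  have h := (hbound i).trans (Int.le_ceil _)
  rw [← hN, abs_le] at h
  exact ⟨by exact_mod_cast h.1, by exact_mod_cast h.2⟩

/-- The support of `s ↦ f(δ·triEmbed s)` is finite for compactly supported `f`, `δ > 0`.
[folklore] -/
theorem finite_support_triLattice {f : ℂ → ℂ} (hfc : HasCompactSupport f) {δ : ℝ} (hδ : 0 < δ) :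
    (Function.support fun s : Site 2 => f ((δ : ℂ) * triEmbed s)).Finite := by
  obtain ⟨R, hR⟩ := hfc.isCompact.isBounded.subset_closedBall 0
  refine (finite_triLattice_norm_le hδ R).subset fun s hs => ?_
  have hK : (δ : ℂ) * triEmbed s ∈ tsupport f := subset_tsupport _ (Function.mem_support.2 hs)
  have := hR hK
  rwa [mem_closedBall, dist_zero_right] at this

/-- **Riemann sums over the triangular lattice**: for continuous compactly supported
`f : ℂ → ℂ`, `δ² Σ_{s ∈ ℤ²} f(δ · triEmbed s) → (2/√3) ∫ f` as `δ → 0⁺` (the unit triangular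
lattice has `2/√3` sites per unit area).  Proof: the real-linear map `x + iy ↦ x + yζ` has
determinant `√3/2` and carries `ℤ + iℤ` onto `triEmbed ℤ²`; change variables in
`tendsto_sqLattice_sum`. [folklore] -/
theorem tendsto_triLattice_sum {f : ℂ → ℂ} (hf : Continuous f) (hfc : HasCompactSupport f) :
    Tendsto (fun δ : ℝ => (δ : ℂ) ^ 2 * ∑ᶠ s : Site 2, f ((δ : ℂ) * triEmbed s)) (𝓝[>] 0)
      (𝓝 (((2 / Real.sqrt 3 : ℝ) : ℂ) * ∫ z, f z)) := by
  -- the skew map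
  let Φ : ℂ →ₗ[ℝ] ℂ :=
    { toFun := fun z => (z.re : ℂ) + (z.im : ℂ) * triZeta
      map_add' := fun z w => by
        simp only [Complex.add_re, Complex.add_im, Complex.ofReal_add]; ring
      map_smul' := fun c z => by
        simp only [Complex.real_smul, RingHom.id_apply, Complex.mul_re, Complex.mul_im,
          Complex.ofReal_re, Complex.ofReal_im, zero_mul, sub_zero, add_zero]
        push_cast; ring }
  have hΦ : ∀ z : ℂ, Φ z = (z.re : ℂ) + (z.im : ℂ) * triZeta := fun z => rfl
  have h3 : (0 : ℝ) < Real.sqrt 3 := Real.sqrt_pos.2 (by norm_num)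
  have hdet : LinearMap.det Φ = Real.sqrt 3 / 2 := by
    rw [← LinearMap.det_toMatrix Complex.basisOneI, Matrix.det_fin_two]
    simp [LinearMap.toMatrix_apply, Complex.coe_basisOneI_repr, Complex.coe_basisOneI, hΦ]
  have hdet0 : LinearMap.det Φ ≠ 0 := by rw [hdet]; positivity
  have hΦc : Continuous Φ := Φ.continuous_of_finiteDimensional
  -- the pulled-back function
  set g : ℂ → ℂ := fun z => f (Φ z) with hgdef
  have hg : Continuous g := hf.comp hΦc
  have hgc : HasCompactSupport g := by
    have h := hfc.comp_homeomorph
      (LinearMap.equivOfDetNeZero Φ hdet0).toContinuousLinearEquiv.toHomeomorph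
    convert h using 1
    funext z
    simp only [hgdef, Function.comp_apply]
    rfl
  -- the square-lattice Riemann sums of `g` are the triangular ones of `f`
  have hpt : ∀ (δ : ℝ) (s : Site 2), g ((δ : ℂ) * ((s 0 : ℂ) + (s 1 : ℂ) * I)) =
      f ((δ : ℂ) * triEmbed s) := by
    intro δ s
    simp only [hgdef, hΦ, triEmbed]
    congr 1
    simp only [Complex.mul_re, Complex.mul_im, Complex.add_re, Complex.add_im, Complex.ofReal_re,
      Complex.ofReal_im, Complex.intCast_re, Complex.intCast_im, Complex.I_re, Complex.I_im]
    push_cast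
    ring
  have hlim := tendsto_sqLattice_sum hg hgc
  simp only [hpt] at hlim
  -- `∫ g = (2/√3) ∫ f`
  have hint : ∫ z, g z = ((2 / Real.sqrt 3 : ℝ) : ℂ) * ∫ z, f z := by
    have hmap := Measure.map_linearMap_addHaar_eq_smul_addHaar (volume : Measure ℂ) hdet0
    have h1 : ∫ z, g z = ∫ y, f y ∂(Measure.map Φ volume) :=
      (integral_map hΦc.measurable.aemeasurable hf.aestronglyMeasurable).symm
    rw [h1, hmap, integral_smul_measure, hdet, ENNReal.toReal_ofReal (abs_nonneg _), inv_div,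
      abs_of_pos (by positivity), Complex.real_smul]
  rwa [hint] at hlim

/-- **Counting lattice points** (registered helper `developingMapLimitHolomorphic_riemann` of stub
`stub_developingMapLimitHolomorphic`, crux stmt-CriticalPhenomena-14004): for every compact
`K ⊆ ℂ` there is `N` such that eventually as `δ → 0⁺`, every finite set of sites `s` with
`δ·triEmbed s ∈ K` has `δ² · card ≤ N` (compare the count with the Riemann sum of a bump
function `χ ≥ 1_K`). [folklore] -/
theorem developingMapLimitHolomorphic_riemann : ∀ (K : Set ℂ), IsCompact K → ∃ N : ℝ, ∀ᶠ δ : ℝ in 𝓝[>] 0, ∀ T : Finset (Fin 2 → ℤ), (∀ s ∈ T, (δ : ℂ) * triEmbed s ∈ K) → δ ^ 2 * (T.card : ℝ) ≤ N := by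
  intro K hK
  classical
  obtain ⟨χ, hχK, -, hχc, hχ01⟩ := exists_continuous_one_zero_of_isCompact hK isClosed_empty
    (Set.disjoint_empty K)
  set f : ℂ → ℂ := fun z => ((χ z : ℝ) : ℂ) with hfdef
  have hf : Continuous f := Complex.continuous_ofReal.comp χ.continuous
  have hfc : HasCompactSupport f :=
    hχc.comp_left (g := fun x : ℝ => (x : ℂ)) Complex.ofReal_zero
  have hlim := tendsto_triLattice_sum hf hfc
  set L : ℂ := ((2 / Real.sqrt 3 : ℝ) : ℂ) * ∫ z, f z with hL
  refine ⟨‖L‖ + 1, ?_⟩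
  have hev : ∀ᶠ δ : ℝ in 𝓝[>] 0,
      dist ((δ : ℂ) ^ 2 * ∑ᶠ s : Site 2, f ((δ : ℂ) * triEmbed s)) L < 1 :=
    Metric.tendsto_nhds.1 hlim 1 one_pos
  filter_upwards [hev, self_mem_nhdsWithin] with δ hδ hδpos T hT
  have hδ0 : (0 : ℝ) < δ := hδpos
  -- the finite support of the lattice sum
  have hfin := finite_support_triLattice hfc hδ0
  set S : Finset (Site 2) := hfin.toFinset with hS
  have hsupp : (Function.support fun s : Site 2 => f ((δ : ℂ) * triEmbed s)) ⊆ ↑S := by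
    rw [hS, Set.Finite.coe_toFinset]
  rw [finsum_eq_sum_of_support_subset _ hsupp] at hδ
  -- the lattice sum is real, `≥ δ² card T`
  have hreal : (δ : ℂ) ^ 2 * ∑ s ∈ S, f ((δ : ℂ) * triEmbed s) =
      ((δ ^ 2 * ∑ s ∈ S, χ ((δ : ℂ) * triEmbed s) : ℝ) : ℂ) := by
    simp only [hfdef]; push_cast; rfl
  have hTS : T ⊆ S := by
    intro s hs
    rw [hS, Set.Finite.mem_toFinset, Function.mem_support]
    simp only [hfdef]
    rw [hχK (hT s hs)]
    simp
  have hcount : δ ^ 2 * (T.card : ℝ) ≤ δ ^ 2 * ∑ s ∈ S, χ ((δ : ℂ) * triEmbed s) := by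
    refine mul_le_mul_of_nonneg_left ?_ (sq_nonneg δ)
    calc (T.card : ℝ) = ∑ s ∈ T, (1 : ℝ) := by simp
      _ = ∑ s ∈ T, χ ((δ : ℂ) * triEmbed s) :=
          Finset.sum_congr rfl fun s hs => (hχK (hT s hs)).symm
      _ ≤ ∑ s ∈ S, χ ((δ : ℂ) * triEmbed s) :=
          Finset.sum_le_sum_of_subset_of_nonneg hTS fun s _ _ => (hχ01 _).1
  have hnorm : ‖((δ ^ 2 * ∑ s ∈ S, χ ((δ : ℂ) * triEmbed s) : ℝ) : ℂ)‖ ≤ ‖L‖ + 1 := by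
    rw [hreal, dist_eq_norm] at hδ
    have := norm_sub_norm_le (((δ ^ 2 * ∑ s ∈ S, χ ((δ : ℂ) * triEmbed s) : ℝ) : ℂ)) L
    linarith
  rw [Complex.norm_real, Real.norm_eq_abs] at hnorm
  exact hcount.trans ((le_abs_self _).trans hnorm)

end Summit.CriticalPhenomena.SAWScalingLimit.Theorems.PickHalfPlane.DevelopingMap

end
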